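import Literature.Topology.FourManifolds.KhTriangleSectors
import Literature.Topology.FourManifolds.KhTriangleLoop
import Literature.Topology.FourManifolds.KhFlipDegree
import HarnessLib

/-!
# The third Reidemeister move: the bijection between the rests of the two sides

Sibling file of `KhComplex.lean`, continuing `KhTriangleSectors.lean` and `KhTriangleLoop.lean`.
After the Gaussian elimination of the loop squares of `G` and of `G' = G.braidMove x y z`
(`KhLoopSquareElim.lean`), the Khovanov cochains of both sides retract onto their **rests**
`R = Z₀ ⊔ D₁` (enhanced states with `z = 0`, or with `(x, y, z) = (0, 1, 1)`). This file
constructs the bijection `restEquiv : R(G) ≃ R(G')` through which the two reduced complexes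
are compared (`KhTriangleIso.lean`):

* on states, `swapSt`: the smoothings of `x` and `y` are exchanged when `z = 0` and kept when
  `z = 1` (the layers `z = 0` of the two sides agree after exchanging `x` and `y`, the sectors
  `D₁` agree as they are);
* on labels, every arc off the triangle keeps its label and each side of the triangle takes the
  label of the end it is attached to (`toG'`, `toG`; `toG'_label_of_not_inT`), which is
  legitimate by the sector transfers of `KhTriangleSectors.lean`;
* `restEquiv` preserves the homological and the quantum degree (`homDegree_toG'`,
  `qDegree_toG'`, through the bijection of state circles `circleEquivG'`).

No named fact is introduced.

## References

* M. Khovanov, *A categorification of the Jones polynomial*, Duke Math. J. 101 (2000) 359–426,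
  §5.4. [cite: Khovanov2000, §5.4]
* D. Bar-Natan, *On Khovanov's categorification of the Jones polynomial*, Algebr. Geom. Topol. 2
  (2002) 337–370, §4.4. [cite: BarNatan2002, §4]
-/

open Function Finset

noncomputable section

namespace Literature.Topology.FourManifolds

namespace GaussDiagram

open LocArc

/-! ## The attaching maps are honest in the sectors used -/

/-- In the local graph of `E` every abstract side is attached to an end connected to it.
[folklore] -/
def AttachOK (E : List (LocArc × LocArc)) : Prop :=
  ∀ a ∈ [LocArc.sA, .sB, .sC], ¬ (attach E a).IsSide ∧ locReachB E a (attach E a) = true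

/-- `AttachOK` is decidable. [folklore] -/
instance (E : List (LocArc × LocArc)) : Decidable (AttachOK E) := by unfold AttachOK; infer_instance

set_option maxRecDepth 8192 in
/-- The attaching maps of `G` are honest off the loop sector `(1, 0, 1)`. [folklore] -/
theorem attachOK_G (bx by_ bz : Bool) (h : (bx, by_, bz) ≠ (true, false, true)) : AttachOK (locEdgesG bx by_ bz) := by
  revert h; cases bx <;> cases by_ <;> cases bz <;> decide

set_option maxRecDepth 8192 in
/-- The attaching maps of the braid rearrangement are honest off the loop sector `(1, 0, 1)`.
[folklore] -/
theorem attachOK_G' (bx by_ bz : Bool) (h : (bx, by_, bz) ≠ (true, false, true)) : AttachOK (locEdgesG' bx by_ bz) := by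
  revert h; cases bx <;> cases by_ <;> cases bz <;> decide

/-- The attached end of a side is not a side. [folklore] -/
theorem not_isSide_attach {E : List (LocArc × LocArc)} (h : AttachOK E) {a : LocArc} : ¬ (attach E a).IsSide := by
  by_cases ha : a.IsSide
  · have : a ∈ [LocArc.sA, .sB, .sC] := by cases a <;> simp [LocArc.IsSide] at ha ⊢
    exact (h a this).1
  · rw [attach_of_not_isSide E ha]; exact ha

/-- A side is connected to its attached end in the local graph. [folklore] -/
theorem locGraph_reachable_attach {E : List (LocArc × LocArc)} (h : AttachOK E) (a : LocArc) :
    (locGraph E).Reachable a (attach E a) := by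
  by_cases ha : a.IsSide
  · have : a ∈ [LocArc.sA, .sB, .sC] := by cases a <;> simp [LocArc.IsSide] at ha ⊢
    exact reachable_of_locReachB (h a this).2
  · rw [attach_of_not_isSide E ha]

section Move

variable (G : GaussDiagram) {x y z : Fin G.n}
variable (hxz : x ≠ z) (ha : (G.overPos y : ℕ) = G.overPos x + 1) (hb : (G.overPos z : ℕ) = G.underPos x + 1)
  (hc : (G.underPos z : ℕ) = G.underPos y + 1) (hx : G.sign x = 1) (hy : G.sign y = 1) (hz : G.sign z = 1)

/-! ## The state map -/

variable (x y z) in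
/-- **The state correspondence of the third move on the rests**: exchange the smoothings of `x`
and `y` in the layer `z = 0`, keep everything in the layer `z = 1`. [cite: Khovanov2000, §5.4] -/
def swapSt (σ : G.State) : G.State :=
  if σ z = true then σ else σ ∘ Equiv.swap x y

include hxz hc in
/-- `swapSt` at `z`. [folklore] -/
@[simp] theorem swapSt_z (σ : G.State) : G.swapSt x y z σ z = σ z := by
  unfold swapSt; split_ifs with h
  · rfl
  · simp only [comp_apply]
    rw [Equiv.swap_apply_of_ne_of_ne (fun h ↦ hxz h.symm) (fun h ↦ G.y_ne_z hc h.symm)]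

/-- `swapSt` at `x` in the layer `z = 0`. [folklore] -/
theorem swapSt_x {σ : G.State} (hσ : σ z = false) : G.swapSt x y z σ x = σ y := by
  unfold swapSt; rw [if_neg (by rw [hσ]; exact Bool.false_ne_true)]
  simp

/-- `swapSt` at `y` in the layer `z = 0`. [folklore] -/
theorem swapSt_y {σ : G.State} (hσ : σ z = false) : G.swapSt x y z σ y = σ x := by
  unfold swapSt; rw [if_neg (by rw [hσ]; exact Bool.false_ne_true)]
  simp

/-- `swapSt` in the layer `z = 1`. [folklore] -/
theorem swapSt_of_z {σ : G.State} (hσ : σ z = true) : G.swapSt x y z σ = σ := by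
  unfold swapSt; rw [if_pos hσ]

/-- `swapSt` in the layer `z = 0`. [folklore] -/
theorem swapSt_of_not_z {σ : G.State} (hσ : ¬ σ z = true) : G.swapSt x y z σ = σ ∘ Equiv.swap x y := by
  unfold swapSt; rw [if_neg hσ]

/-- `swapSt` at a fourth chord. [folklore] -/
theorem swapSt_of_ne (σ : G.State) {j : Fin G.n} (hjx : j ≠ x) (hjy : j ≠ y) : G.swapSt x y z σ j = σ j := by
  unfold swapSt; split_ifs
  · rfl
  · simp only [comp_apply]; rw [Equiv.swap_apply_of_ne_of_ne hjx hjy]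

include hxz hc in
/-- `swapSt` is an involution. [folklore] -/
theorem swapSt_swapSt (σ : G.State) : G.swapSt x y z (G.swapSt x y z σ) = σ := by
  by_cases h : σ z = true
  · rw [G.swapSt_of_z h, G.swapSt_of_z h]
  · have h' : ¬ G.swapSt x y z σ z = true := by rwa [G.swapSt_z hxz hc]
    rw [G.swapSt_of_not_z h', G.swapSt_of_not_z h]
    funext i
    simp only [comp_apply, Equiv.swap_apply_self]

/-- `swapSt` keeps the number of `1`-smoothings. [folklore] -/
theorem weight_swapSt (σ : G.State) : (G.swapSt x y z σ).weight = σ.weight := by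
  by_cases h : σ z = true
  · rw [G.swapSt_of_z h]
  · unfold swapSt; rw [if_neg h]
    unfold State.weight
    rw [← Finset.card_map (Equiv.swap x y).toEmbedding]
    congr 1
    ext i
    simp only [Finset.mem_map_equiv, Finset.mem_filter, Finset.mem_univ, true_and, comp_apply,
      Equiv.symm_swap, Equiv.swap_apply_self]

include hxz hc in
/-- **`swapSt` preserves the rests** (`z = 0`, or `(x, y, z) = (0, 1, 1)`). [folklore] -/
theorem rest_swapSt {σ : G.State} (h : ¬ (σ z = true ∧ (σ x = false → σ y = false))) :
    ¬ (G.swapSt x y z σ z = true ∧ (G.swapSt x y z σ x = false → G.swapSt x y z σ y = false)) := by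
  by_cases hzb : σ z = true
  · rwa [G.swapSt_of_z hzb]
  · rw [G.swapSt_z hxz hc]; exact fun h' ↦ hzb h'.1

/-- `swapSt` agrees with the state at the fourth chords. [folklore] -/
theorem swapSt_agree (σ : G.State) : ∀ j, j ≠ x → j ≠ y → j ≠ z → σ j = G.swapSt x y z σ j :=
  fun _ hjx hjy _ ↦ (G.swapSt_of_ne σ hjx hjy).symm

/-! ## Reading labels across the move -/

variable (x y z) in
/-- The retouching used to read, on `G`, the labels of an enhanced state of the rearrangement
over `σ'`: each side goes to the end it is attached to in the rearrangement over `σ'`. [folklore] -/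
def retG'G (σ' : G.State) : G.Arc → G.Arc :=
  G.retouch x y z (attach (locEdgesG' (σ' x) (σ' y) (σ' z)))

variable (x y z) in
/-- The retouching used to read, on the rearrangement, the labels of an enhanced state of `G`
over `σ`. [folklore] -/
def retGG' (σ : G.State) : G.Arc → G.Arc :=
  G.retouch x y z (attach (locEdgesG (σ x) (σ y) (σ z)))

/-- `retG'G` fixes the arcs off the triangle. [folklore] -/
theorem retG'G_of_not_inT (σ' : G.State) {u : G.Arc} (hu : ¬ G.InT x y u) : G.retG'G x y z σ' u = u :=
  G.retouch_of_not_inT _ hu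

/-- `retGG'` fixes the arcs off the triangle. [folklore] -/
theorem retGG'_of_not_inT (σ : G.State) {u : G.Arc} (hu : ¬ G.InT x y u) : G.retGG' x y z σ u = u :=
  G.retouch_of_not_inT _ hu

/-- The smoothings of a rest state are not those of the loop sector. [folklore] -/
theorem bits_ne_of_rest {σ : G.State} (h : ¬ (σ z = true ∧ (σ x = false → σ y = false))) :
    (σ x, σ y, σ z) ≠ (true, false, true) := by
  intro h'
  simp only [Prod.mk.injEq] at h'
  exact h ⟨h'.2.2, fun h'' ↦ by rw [h'.1] at h''; exact Bool.noConfusion h''⟩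

include hxz ha hb hc in
/-- `retG'G` maps every arc off the triangle... and every side to an arc off the triangle, over a
rest state. [folklore] -/
theorem not_inT_retG'G {σ' : G.State} (h : ¬ (σ' z = true ∧ (σ' x = false → σ' y = false))) (u : G.Arc) :
    ¬ G.InT x y (G.retG'G x y z σ' u) := by
  by_cases hu : G.InT x y u
  · obtain ⟨a, -, rfl⟩ := G.exists_locArc_of_inT (z := z) hu
    unfold retG'G
    rw [G.retouch_locArc hxz ha hb hc _ (fun a ha' ↦ attach_of_not_isSide _ ha'), G.inT_locArc_iff hxz ha hb hc]
    exact not_isSide_attach (attachOK_G' _ _ _ (G.bits_ne_of_rest h))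
  · rwa [G.retG'G_of_not_inT σ' hu]

include hxz ha hb hc in
/-- `retGG'` maps every arc to an arc off the triangle, over a rest state. [folklore] -/
theorem not_inT_retGG' {σ : G.State} (h : ¬ (σ z = true ∧ (σ x = false → σ y = false))) (u : G.Arc) :
    ¬ G.InT x y (G.retGG' x y z σ u) := by
  by_cases hu : G.InT x y u
  · obtain ⟨a, -, rfl⟩ := G.exists_locArc_of_inT (z := z) hu
    unfold retGG'
    rw [G.retouch_locArc hxz ha hb hc _ (fun a ha' ↦ attach_of_not_isSide _ ha'), G.inT_locArc_iff hxz ha hb hc]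
    exact not_isSide_attach (attachOK_G _ _ _ (G.bits_ne_of_rest h))
  · rwa [G.retGG'_of_not_inT σ hu]

include hxz ha hb hc hx hy hz in
/-- Every arc is connected to its `retG'G`-image in the rearrangement over a rest state. [folklore] -/
theorem reachable_retG'G {σ' : G.State} (h : ¬ (σ' z = true ∧ (σ' x = false → σ' y = false))) (u : G.Arc) :
    ((G.braidMove x y z).stateGraph σ').Reachable u (G.retG'G x y z σ' u) := by
  by_cases hu : G.InT x y u
  · obtain ⟨a, -, rfl⟩ := G.exists_locArc_of_inT (z := z) hu
    unfold retG'G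
    rw [G.retouch_locArc hxz ha hb hc _ (fun a ha' ↦ attach_of_not_isSide _ ha')]
    exact G.reachable_of_locGraph_reachable _
      (fun e he ↦ G.reachable_braidMove_locArc_of_mem hxz ha hb hc hx hy hz σ' he)
      (locGraph_reachable_attach (attachOK_G' _ _ _ (G.bits_ne_of_rest h)) a)
  · rw [G.retG'G_of_not_inT σ' hu]

include hxz ha hb hc hx hy hz in
/-- Every arc is connected to its `retGG'`-image in `G` over a rest state. [folklore] -/
theorem reachable_retGG' {σ : G.State} (h : ¬ (σ z = true ∧ (σ x = false → σ y = false))) (u : G.Arc) :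
    (G.stateGraph σ).Reachable u (G.retGG' x y z σ u) := by
  by_cases hu : G.InT x y u
  · obtain ⟨a, -, rfl⟩ := G.exists_locArc_of_inT (z := z) hu
    unfold retGG'
    rw [G.retouch_locArc hxz ha hb hc _ (fun a ha' ↦ attach_of_not_isSide _ ha')]
    exact G.reachable_of_locGraph_reachable _
      (fun e he ↦ G.reachable_locArc_of_mem ha hb hc hx hy hz σ he)
      (locGraph_reachable_attach (attachOK_G _ _ _ (G.bits_ne_of_rest h)) a)
  · rw [G.retGG'_of_not_inT σ hu]

include hxz ha hb hc hx hy hz in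
/-- **Transfer of circles from the rearrangement to `G` on the rests**: arcs on one circle of
the rearrangement over `swapSt σ` have `retG'G`-images on one circle of `G` over `σ`.
[cite: Khovanov2000, §5.4] -/
theorem reach_rest_G'_G {σ : G.State} (h : ¬ (σ z = true ∧ (σ x = false → σ y = false))) {u v : G.Arc}
    (huv : ((G.braidMove x y z).stateGraph (G.swapSt x y z σ)).Reachable u v) :
    (G.stateGraph σ).Reachable (G.retG'G x y z (G.swapSt x y z σ) u) (G.retG'G x y z (G.swapSt x y z σ) v) := by
  have hτ : ∀ j, j ≠ x → j ≠ y → j ≠ z → G.swapSt x y z σ j = σ j :=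
    fun j hjx hjy hjz ↦ (G.swapSt_agree σ j hjx hjy hjz).symm
  cases hzb : σ z
  · have e1 := G.swapSt_x (x := x) (y := y) hzb; have e2 := G.swapSt_y (x := x) (y := y) hzb
    have e3 : G.swapSt x y z σ z = false := by rw [G.swapSt_z hxz hc, hzb]
    have key := G.reach_G'_G hxz ha hb hc hx hy hz (locCheck_Z0_G'_G (σ x) (σ y)) hτ e1 e2 e3 rfl rfl hzb huv
    unfold retG'G; rw [e1, e2, e3]; exact key
  · have hσ : σ x = false ∧ σ y = true := by
      cases hxb : σ x <;> cases hyb : σ y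
      · exact (h ⟨hzb, fun _ ↦ hyb⟩).elim
      · exact ⟨rfl, rfl⟩
      · exact (h ⟨hzb, fun h' ↦ by rw [hxb] at h'; exact Bool.noConfusion h'⟩).elim
      · exact (h ⟨hzb, fun h' ↦ by rw [hxb] at h'; exact Bool.noConfusion h'⟩).elim
    have es := G.swapSt_of_z (x := x) (y := y) hzb
    rw [es] at huv ⊢
    have key := G.reach_G'_G hxz ha hb hc hx hy hz locCheck_D.2 (fun _ _ _ _ ↦ rfl) hσ.1 hσ.2 hzb hσ.1 hσ.2 hzb huv
    unfold retG'G; rw [hσ.1, hσ.2, hzb]; exact key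

include hxz ha hb hc hx hy hz in
/-- **Transfer of circles from `G` to the rearrangement on the rests.** [cite: Khovanov2000, §5.4] -/
theorem reach_rest_G_G' {σ : G.State} (h : ¬ (σ z = true ∧ (σ x = false → σ y = false))) {u v : G.Arc}
    (huv : (G.stateGraph σ).Reachable u v) :
    ((G.braidMove x y z).stateGraph (G.swapSt x y z σ)).Reachable (G.retGG' x y z σ u) (G.retGG' x y z σ v) := by
  have hτ : ∀ j, j ≠ x → j ≠ y → j ≠ z → σ j = G.swapSt x y z σ j := G.swapSt_agree σ
  cases hzb : σ z
  · have e1 := G.swapSt_x (x := x) (y := y) hzb; have e2 := G.swapSt_y (x := x) (y := y) hzb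
    have e3 : G.swapSt x y z σ z = false := by rw [G.swapSt_z hxz hc, hzb]
    have key := G.reach_G_G' hxz ha hb hc hx hy hz (locCheck_Z0_G_G' (σ x) (σ y)) hτ rfl rfl hzb e1 e2 e3 huv
    unfold retGG'; rw [hzb]; exact key
  · have hσ : σ x = false ∧ σ y = true := by
      cases hxb : σ x <;> cases hyb : σ y
      · exact (h ⟨hzb, fun _ ↦ hyb⟩).elim
      · exact ⟨rfl, rfl⟩
      · exact (h ⟨hzb, fun h' ↦ by rw [hxb] at h'; exact Bool.noConfusion h'⟩).elim
      · exact (h ⟨hzb, fun h' ↦ by rw [hxb] at h'; exact Bool.noConfusion h'⟩).elim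
    have es := G.swapSt_of_z (x := x) (y := y) hzb
    rw [es]
    have key := G.reach_G_G' hxz ha hb hc hx hy hz locCheck_D.1 (fun _ _ _ _ ↦ rfl) hσ.1 hσ.2 hzb hσ.1 hσ.2 hzb huv
    unfold retGG'; rw [hσ.1, hσ.2, hzb]; exact key

/-! ## The enhanced states across the move -/

include hxz ha hb hc hx hy hz in
/-- **The enhanced state of the rearrangement corresponding to a rest state of `G`**: exchange
the smoothings of `x, y` in the layer `z = 0`, keep the labels off the triangle, label each side
as the end it is attached to. Khovanov (2000), §5.4; Bar-Natan (2002), §4.4. [cite: Khovanov2000, §5.4] -/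
def toG' (t : G.EnhancedState) (h : ¬ (t.state z = true ∧ (t.state x = false → t.state y = false))) :
    (G.braidMove x y z).EnhancedState where
  state := G.swapSt x y z t.state
  label u := t.label (G.retG'G x y z (G.swapSt x y z t.state) u)
  label_eq _ _ huv := t.label_eq_of_reachable (G.reach_rest_G'_G hxz ha hb hc hx hy hz h huv.reachable)

include hxz ha hb hc hx hy hz in
/-- **The enhanced state of `G` corresponding to a rest state of the rearrangement.**
[cite: Khovanov2000, §5.4] -/
def toG (t' : (G.braidMove x y z).EnhancedState)
    (h : ¬ (t'.state z = true ∧ (t'.state x = false → t'.state y = false))) : G.EnhancedState where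
  state := G.swapSt x y z t'.state
  label u := t'.label (G.retGG' x y z (G.swapSt x y z t'.state) u)
  label_eq _ _ huv := by
    apply t'.label_eq_of_reachable
    have key := G.reach_rest_G_G' hxz ha hb hc hx hy hz (σ := G.swapSt x y z t'.state)
      (G.rest_swapSt hxz hc h) huv.reachable
    rwa [G.swapSt_swapSt hxz hc] at key

/-- The state of `toG' t`. [folklore] -/
@[simp] theorem toG'_state (t : G.EnhancedState) (h) :
    (G.toG' hxz ha hb hc hx hy hz t h).state = G.swapSt x y z t.state := rfl

/-- The state of `toG t'`. [folklore] -/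
@[simp] theorem toG_state (t' : (G.braidMove x y z).EnhancedState) (h) :
    (G.toG hxz ha hb hc hx hy hz t' h).state = G.swapSt x y z t'.state := rfl

/-- The labels of `toG' t`. [folklore] -/
theorem toG'_label (t : G.EnhancedState) (h) (u : G.Arc) :
    (G.toG' hxz ha hb hc hx hy hz t h).label u = t.label (G.retG'G x y z (G.swapSt x y z t.state) u) := rfl

/-- The labels of `toG t'`. [folklore] -/
theorem toG_label (t' : (G.braidMove x y z).EnhancedState) (h) (u : G.Arc) :
    (G.toG hxz ha hb hc hx hy hz t' h).label u = t'.label (G.retGG' x y z (G.swapSt x y z t'.state) u) := rfl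

/-- **`toG' t` has the labels of `t` off the triangle.** [folklore] -/
theorem toG'_label_of_not_inT (t : G.EnhancedState) (h) {u : G.Arc} (hu : ¬ G.InT x y u) :
    (G.toG' hxz ha hb hc hx hy hz t h).label u = t.label u := by
  rw [toG'_label, G.retG'G_of_not_inT _ hu]

/-- **`toG t'` has the labels of `t'` off the triangle.** [folklore] -/
theorem toG_label_of_not_inT (t' : (G.braidMove x y z).EnhancedState) (h) {u : G.Arc} (hu : ¬ G.InT x y u) :
    (G.toG hxz ha hb hc hx hy hz t' h).label u = t'.label u := by
  rw [toG_label, G.retGG'_of_not_inT _ hu]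

/-- `toG' t` is a rest state. [folklore] -/
theorem rest_toG' (t : G.EnhancedState) (h) :
    ¬ ((G.toG' hxz ha hb hc hx hy hz t h).state z = true ∧
      ((G.toG' hxz ha hb hc hx hy hz t h).state x = false → (G.toG' hxz ha hb hc hx hy hz t h).state y = false)) :=
  G.rest_swapSt hxz hc h

/-- `toG t'` is a rest state. [folklore] -/
theorem rest_toG (t' : (G.braidMove x y z).EnhancedState) (h) :
    ¬ ((G.toG hxz ha hb hc hx hy hz t' h).state z = true ∧
      ((G.toG hxz ha hb hc hx hy hz t' h).state x = false → (G.toG hxz ha hb hc hx hy hz t' h).state y = false)) :=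
  G.rest_swapSt hxz hc h

/-- **Round trip** `toG (toG' t) = t`. [folklore] -/
theorem toG_toG' (t : G.EnhancedState) (h) :
    G.toG hxz ha hb hc hx hy hz (G.toG' hxz ha hb hc hx hy hz t h) (G.rest_toG' hxz ha hb hc hx hy hz t h) = t := by
  refine EnhancedState.ext' (by rw [toG_state, toG'_state, G.swapSt_swapSt hxz hc]) (funext fun u ↦ ?_)
  rw [toG_label, toG'_label]
  simp only [toG'_state, G.swapSt_swapSt hxz hc]
  -- `u ~ retGG' u` in `G`, an arc off the triangle, fixed by `retG'G`
  rw [G.retG'G_of_not_inT _ (G.not_inT_retGG' hxz ha hb hc h u)]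
  exact (t.label_eq_of_reachable (G.reachable_retGG' hxz ha hb hc hx hy hz h u)).symm

/-- **Round trip** `toG' (toG t') = t'`. [folklore] -/
theorem toG'_toG (t' : (G.braidMove x y z).EnhancedState) (h) :
    G.toG' hxz ha hb hc hx hy hz (G.toG hxz ha hb hc hx hy hz t' h) (G.rest_toG hxz ha hb hc hx hy hz t' h) = t' := by
  refine EnhancedState.ext' (by rw [toG'_state, toG_state, G.swapSt_swapSt hxz hc]) (funext fun u ↦ ?_)
  rw [toG'_label, toG_label]
  simp only [toG_state, G.swapSt_swapSt hxz hc]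
  rw [G.retGG'_of_not_inT _ (G.not_inT_retG'G hxz ha hb hc h u)]
  exact (t'.label_eq_of_reachable (G.reachable_retG'G hxz ha hb hc hx hy hz h u)).symm

/-- **The bijection between the rests of the two sides of the third move.** [cite: Khovanov2000, §5.4] -/
def restEquiv : (G.triLoopSq hxz ha hb hc hx hy hz).XR ≃ (G.triLoopSq' hxz ha hb hc hx hy hz).XR where
  toFun r := ⟨G.toG' hxz ha hb hc hx hy hz r.1 r.2, G.rest_toG' hxz ha hb hc hx hy hz r.1 r.2⟩
  invFun r' := ⟨G.toG hxz ha hb hc hx hy hz r'.1 r'.2, G.rest_toG hxz ha hb hc hx hy hz r'.1 r'.2⟩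
  left_inv r := Subtype.ext (G.toG_toG' hxz ha hb hc hx hy hz r.1 r.2)
  right_inv r' := Subtype.ext (G.toG'_toG hxz ha hb hc hx hy hz r'.1 r'.2)

/-- `restEquiv` is `toG'`. [folklore] -/
@[simp] theorem restEquiv_apply (r : (G.triLoopSq hxz ha hb hc hx hy hz).XR) :
    (G.restEquiv hxz ha hb hc hx hy hz r).1 = G.toG' hxz ha hb hc hx hy hz r.1 r.2 := rfl

/-- The inverse of `restEquiv` is `toG`. [folklore] -/
@[simp] theorem restEquiv_symm_apply (r' : (G.triLoopSq' hxz ha hb hc hx hy hz).XR) :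
    ((G.restEquiv hxz ha hb hc hx hy hz).symm r').1 = G.toG hxz ha hb hc hx hy hz r'.1 r'.2 := rfl

/-! ## Degrees -/

/-- The braid rearrangement has as many negative chords. [folklore] -/
theorem nMinus_braidMove : (G.braidMove x y z).nMinus = G.nMinus := rfl

/-- The braid rearrangement has as many positive chords. [folklore] -/
theorem nPlus_braidMove : (G.braidMove x y z).nPlus = G.nPlus := rfl

/-- **`toG'` preserves the homological degree.** [folklore] -/
theorem homDegree_toG' (t : G.EnhancedState) (h) : homDegree (G.toG' hxz ha hb hc hx hy hz t h) = homDegree t := by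
  unfold homDegree
  have hw : (G.toG' hxz ha hb hc hx hy hz t h).state.weight = t.state.weight := G.weight_swapSt t.state
  rw [hw]; rfl

include hxz ha hb hc hx hy hz in
/-- **The bijection of state circles across the move on the rests.** [folklore] -/
def circleEquivG' {σ : G.State} (h : ¬ (σ z = true ∧ (σ x = false → σ y = false))) :
    (G.braidMove x y z).StateCircle (G.swapSt x y z σ) ≃ G.StateCircle σ where
  toFun := SimpleGraph.ConnectedComponent.lift (fun u ↦ G.circleOf σ (G.retG'G x y z (G.swapSt x y z σ) u))
    (fun _ _ p _ ↦ circleOf_eq_iff.2 (G.reach_rest_G'_G hxz ha hb hc hx hy hz h ⟨p⟩))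
  invFun := SimpleGraph.ConnectedComponent.lift
    (fun u ↦ (G.braidMove x y z).circleOf (G.swapSt x y z σ) (G.retGG' x y z σ u))
    (fun _ _ p _ ↦ circleOf_eq_iff.2 (G.reach_rest_G_G' hxz ha hb hc hx hy hz h ⟨p⟩))
  left_inv C' := by
    induction C' using SimpleGraph.ConnectedComponent.ind with | h u => ?_
    change (G.braidMove x y z).circleOf _ (G.retGG' x y z σ (G.retG'G x y z _ u)) = (G.braidMove x y z).circleOf _ u
    rw [G.retGG'_of_not_inT σ (G.not_inT_retG'G hxz ha hb hc (G.rest_swapSt hxz hc h) u)]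
    exact (circleOf_eq_iff.2 (G.reachable_retG'G hxz ha hb hc hx hy hz (G.rest_swapSt hxz hc h) u)).symm
  right_inv C := by
    induction C using SimpleGraph.ConnectedComponent.ind with | h u => ?_
    change G.circleOf σ (G.retG'G x y z _ (G.retGG' x y z σ u)) = G.circleOf σ u
    rw [G.retG'G_of_not_inT _ (G.not_inT_retGG' hxz ha hb hc h u)]
    exact (circleOf_eq_iff.2 (G.reachable_retGG' hxz ha hb hc hx hy hz h u)).symm

/-- The labels of circles correspond under `toG'`. [folklore] -/
theorem circleLabel_toG' (t : G.EnhancedState) (h)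
    (C' : (G.braidMove x y z).StateCircle (G.toG' hxz ha hb hc hx hy hz t h).state) :
    circleLabel (G.toG' hxz ha hb hc hx hy hz t h) C' = circleLabel t (G.circleEquivG' hxz ha hb hc hx hy hz h C') := by
  induction C' using SimpleGraph.ConnectedComponent.ind with | h u => ?_
  rfl

/-- **`toG'` preserves the quantum degree.** [folklore] -/
theorem qDegree_toG' (t : G.EnhancedState) (h) : qDegree (G.toG' hxz ha hb hc hx hy hz t h) = qDegree t := by
  have hsum : ∑ C', labelDeg (circleLabel (G.toG' hxz ha hb hc hx hy hz t h) C') = ∑ C, labelDeg (circleLabel t C) :=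
    Fintype.sum_equiv (G.circleEquivG' hxz ha hb hc hx hy hz h) _ _ (fun C' ↦ by rw [circleLabel_toG'])
  have hw : (G.toG' hxz ha hb hc hx hy hz t h).state.weight = t.state.weight := G.weight_swapSt t.state
  rw [qDegree_eq_sum_circleLabel, qDegree_eq_sum_circleLabel, hsum, hw]
  rfl

end Move

end GaussDiagram

end Literature.Topology.FourManifolds
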